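import Summits.PneNP.PneNP.Theses.SymmetryBudget
import Literature.Computability.Complexity.SymmetricCircuit
import Literature.Computability.Complexity.CircuitRestriction

/-!
# `WindowHam` (crux `stmt-PneNP-2143`, route `SymmetryBudget`): read-back, the exact shape of a
# refutation, order of strength along the symmetry budget, small-`m` facts (negative-side support)

Support file of the crux disprover (cdisprove seat). Proved here, `sorry`-free, nothing positive about
any route item:

* `windowHam_iff_hasSymCircuit` — the crux is verbatim (`Iff.rfl`) the statement over the landed
  vocabulary `HasSymCircuit tcBasis (pointStabiliserBudget m ⌊log₂ m⌋) (p m) HAM_m` of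
  `Literature/Computability/Complexity/SymmetricCircuit.lean`;
* `not_windowHam_iff` — a refutation is exactly ONE polynomial `p` and a threshold `N` with a
  `Bud(m,⌊log₂ m⌋)`-symmetric threshold circuit of `≤ p m` gates for Hamiltonicity at every `m ≥ N`;
  `windowHam_false_imp_generalCircuits` — dropping symmetry, a refutation yields polynomial-size
  threshold circuits for Hamiltonicity of all large `m`-vertex graphs (informally HAMCYCLE ∈ P/poly,
  NP ⊆ P/poly): the crux cannot be killed unconditionally short of that;
* `hasSymCircuit_of_budget_le`, `windowHam_false_of_hasSym_budget_ge`,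
  `windowHam_false_of_not_polylogHam` — the statement is monotone in the budget: symmetric circuits
  under any LARGER budget `g m ≥ ⌊log₂ m⌋` (eventually, one polynomial) refute it, and the support
  item `PolylogHam` (budget `⌊log₂ m⌋²`) is implied by it;
* `hamFn_one`, `hamFn_two`, `hasSym_const`, `hasSym_hamFn_one`, `hasSym_hamFn_two`, `not_windowHam_everywhere` —
  `HAM_1 ≡ true`, `HAM_2 ≡ false` have one-gate symmetric circuits, so the `∃ᶠ m` of the crux cannot
  be strengthened to "every `m ≥ 1`" (skeleton stubs need a threshold);
* `isSymmetricUnder_of_inputs_fixed`, `hasSymCircuit_of_inputs_fixed`, `bud_fixes_ordered` — a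
  circuit wired only to `Γ`-fixed entries is `Γ`-symmetric (identity automorphism): for functions of
  the ordered block symmetric size = general size, so the crux lives only through the free vertices.
-/

namespace Summit.PneNP.PneNP.Theorems.WindowHam.Negative

open Literature.Computability.Complexity Filter
open Summit.PneNP.PneNP.Theses.SymmetryBudget (WindowHam PolylogHam)
open scoped Classical

/-! ## §1 Read-back -/

/-- The crux, verbatim over the landed vocabulary (the inline `let`s of the route file ARE
`Circuit.IsSymmetricUnder`, `HasSymCircuit`, `pointStabiliserBudget`). -/
theorem windowHam_iff_hasSymCircuit :
    WindowHam ↔ ∀ p : Polynomial ℕ, ∃ᶠ m in atTop,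
      ¬ HasSymCircuit tcBasis (pointStabiliserBudget m (Nat.log 2 m)) (p.eval m) (fun x : Fin m × Fin m → Bool =>
        decide (SimpleGraph.fromRel fun u v => x (u, v) = true).IsHamiltonian) :=
  Iff.rfl

/-- The support item `PolylogHam`, verbatim: the same statement at budget `⌊log₂ m⌋²`. -/
theorem polylogHam_iff_hasSymCircuit :
    PolylogHam ↔ ∀ p : Polynomial ℕ, ∃ᶠ m in atTop,
      ¬ HasSymCircuit tcBasis (pointStabiliserBudget m (Nat.log 2 m ^ 2)) (p.eval m) (fun x : Fin m × Fin m → Bool =>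
        decide (SimpleGraph.fromRel fun u v => x (u, v) = true).IsHamiltonian) :=
  Iff.rfl

/-! ## §2 The exact shape of a refutation, and what it would deliver -/

/-- `¬ WindowHam` unfolded: ONE polynomial and a threshold beyond which `Bud(m,⌊log₂ m⌋)`-symmetric
threshold circuits with `≤ p m` gates for Hamiltonicity exist at EVERY `m`. -/
theorem not_windowHam_iff :
    ¬ WindowHam ↔ ∃ p : Polynomial ℕ, ∃ N : ℕ, ∀ m ≥ N,
      HasSymCircuit tcBasis (pointStabiliserBudget m (Nat.log 2 m)) (p.eval m) (fun x : Fin m × Fin m → Bool =>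
        decide (SimpleGraph.fromRel fun u v => x (u, v) = true).IsHamiltonian) := by
  rw [windowHam_iff_hasSymCircuit]
  push Not
  exact exists_congr fun p => Filter.eventually_atTop

/-- A refutation of the crux yields polynomial-size threshold circuits (symmetry dropped) for
Hamiltonicity of `m`-vertex graphs at all large `m` — informally HAMCYCLE ∈ P/poly and NP ⊆ P/poly
(Muroga's weight bound makes the unbounded fan-in / repeated-wire threshold gates harmless). -/
theorem windowHam_false_imp_generalCircuits (h : ¬ WindowHam) :
    ∃ p : Polynomial ℕ, ∃ N : ℕ, ∀ m ≥ N, ∃ C : Circuit (Fin m × Fin m),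
      C.IsOver tcBasis ∧ C.size ≤ p.eval m ∧ C.Computes (fun x : Fin m × Fin m → Bool =>
        decide (SimpleGraph.fromRel fun u v => x (u, v) = true).IsHamiltonian) := by
  obtain ⟨p, N, hN⟩ := not_windowHam_iff.1 h
  exact ⟨p, N, fun m hm => by
    obtain ⟨C, hB, hs, -, hf⟩ := hN m hm
    exact ⟨C, hB, hs, hf⟩⟩

/-! ## §3 Order of strength along the budget -/

/-- Symmetry under a larger budget is symmetry under a smaller one. -/
theorem hasSymCircuit_of_budget_le {m g g' s : ℕ} {B : Set GateFn}
    {f : (Fin m × Fin m → Bool) → Bool} (hg : g ≤ g')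
    (h : HasSymCircuit B (pointStabiliserBudget m g') s f) :
    HasSymCircuit B (pointStabiliserBudget m g) s f := by
  obtain ⟨C, hB, hs, hΓ, hf⟩ := h
  exact ⟨C, hB, hs, hΓ.mono (pointStabiliserBudget_mono m hg), hf⟩

/-- Symmetric poly-size circuits for HAM under any budget `g m ≥ ⌊log₂ m⌋`, eventually and for one
polynomial, refute the crux (the larger the budget of a construction, the more it kills). -/
theorem windowHam_false_of_hasSym_budget_ge {g : ℕ → ℕ} (hg : ∀ m, Nat.log 2 m ≤ g m)
    (h : ∃ p : Polynomial ℕ, ∃ N : ℕ, ∀ m ≥ N,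
      HasSymCircuit tcBasis (pointStabiliserBudget m (g m)) (p.eval m) (fun x : Fin m × Fin m → Bool =>
        decide (SimpleGraph.fromRel fun u v => x (u, v) = true).IsHamiltonian)) :
    ¬ WindowHam := by
  obtain ⟨p, N, hN⟩ := h
  exact not_windowHam_iff.2 ⟨p, N, fun m hm => hasSymCircuit_of_budget_le (hg m) (hN m hm)⟩

/-- `⌊log₂ m⌋ ≤ ⌊log₂ m⌋²`. -/
theorem log_le_log_sq (m : ℕ) : Nat.log 2 m ≤ Nat.log 2 m ^ 2 := by
  rcases Nat.eq_zero_or_pos (Nat.log 2 m) with h0 | hpos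
  · simp [h0]
  · calc Nat.log 2 m = Nat.log 2 m ^ 1 := (pow_one _).symm
      _ ≤ Nat.log 2 m ^ 2 := Nat.pow_le_pow_right hpos (by norm_num)

/-- The crux is at least as strong as the support item `PolylogHam` (budget `⌊log₂ m⌋²`, a theorem
in print via the Dawar–Wilsenach support theorem and the linear counting width of Hamiltonicity):
were `PolylogHam` false, so would be the crux. -/
theorem windowHam_false_of_not_polylogHam (h : ¬ PolylogHam) : ¬ WindowHam := by
  intro hW
  refine h (polylogHam_iff_hasSymCircuit.2 fun p => ?_)
  exact ((windowHam_iff_hasSymCircuit.1 hW) p).mono fun m hm hm' =>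
    hm (hasSymCircuit_of_budget_le (log_le_log_sq m) hm')

/-- With budget `0` only the identity acts and the symmetry condition is void: `HasSymCircuit` is
plain circuit existence. (So the budget-`0` version of the crux is the general threshold-circuit
lower bound for HAM, which implies the crux by `hasSymCircuit_of_budget_le`.) -/
theorem hasSymCircuit_budget_zero_iff {m s : ℕ} {B : Set GateFn}
    {f : (Fin m × Fin m → Bool) → Bool} :
    HasSymCircuit B (pointStabiliserBudget m 0) s f ↔
      ∃ C : Circuit (Fin m × Fin m), C.IsOver B ∧ C.size ≤ s ∧ C.Computes f := by
  rw [pointStabiliserBudget_zero]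
  exact ⟨fun ⟨C, hB, hs, _, hf⟩ => ⟨C, hB, hs, hf⟩,
    fun ⟨C, hB, hs, hf⟩ => ⟨C, hB, hs, C.isSymmetricUnder_one, hf⟩⟩

/-! ## §4 Small `m`: the `∃ᶠ` cannot become "every `m ≥ 1`" -/

/-- `HAM_1 ≡ true`: Mathlib's `IsHamiltonian` is vacuous on one vertex. -/
theorem hamFn_one :
    (fun x : Fin 1 × Fin 1 → Bool =>
        decide (SimpleGraph.fromRel fun u v => x (u, v) = true).IsHamiltonian) = fun _ => true := by
  funext x
  exact decide_eq_true (SimpleGraph.IsHamiltonian.of_card_eq_one (by simp))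

/-- `HAM_2 ≡ false`: no Hamiltonian cycle on two vertices. -/
theorem hamFn_two :
    (fun x : Fin 2 × Fin 2 → Bool =>
        decide (SimpleGraph.fromRel fun u v => x (u, v) = true).IsHamiltonian) = fun _ => false := by
  funext x
  exact decide_eq_false (SimpleGraph.not_isHamiltonian_of_card_eq_two (by simp))

/-- A one-gate circuit with no argument wires is symmetric under every set of permutations. -/
theorem isSymmetricUnder_of_singleton_nullary {m : ℕ} (C : Circuit (Fin m × Fin m))
    (op : (Fin 0 → Bool) → Bool) (hC : C.gates = [⟨0, op, Fin.elim0⟩]) (hout : C.output = .inr 0)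
    (Γ : Set (Equiv.Perm (Fin m))) : C.IsSymmetricUnder Γ := by
  intro ρ _
  refine ⟨1, ?_, ?_⟩
  · rw [hout]
    show Sum.inr (Circuit.relabelGate (1 : Equiv.Perm (Fin C.gates.length)) 0) = Sum.inr 0
    rw [Circuit.relabelGate_of_lt _ (by rw [hC]; exact Nat.one_pos)]
    rfl
  · intro j
    obtain ⟨j, hj⟩ := j
    have hj0 : j = 0 := by rw [hC] at hj; simp only [List.length_singleton] at hj; omega
    subst hj0
    refine ⟨rfl, ?_⟩
    have hg : C.gates[(0 : ℕ)]'hj = ⟨0, op, Fin.elim0⟩ := by simp [hC]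
    have harity : (C.gates[(0 : ℕ)]'hj).arity = 0 := by rw [hg]
    have hnil : List.ofFn (C.gates[(0 : ℕ)]'hj).args = [] := by
      rw [List.ofFn_eq_nil_iff]; exact harity
    show (List.ofFn (C.gates[((1 : Equiv.Perm (Fin C.gates.length)) ⟨0, hj⟩ : ℕ)].args)).Perm
      ((List.ofFn (C.gates[(0 : ℕ)]'hj).args).map _)
    simp only [Equiv.Perm.coe_one, id_eq]
    rw [hnil]
    simp

/-- The library's constant circuit `Circuit.const _ b` is a one-gate `tcBasis`-circuit, symmetric under
every `Γ`, computing the constant `b`. -/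
theorem hasSym_const (m : ℕ) (Γ : Set (Equiv.Perm (Fin m))) (b : Bool) :
    HasSymCircuit tcBasis Γ 1 (fun _ : Fin m × Fin m → Bool => b) :=
  ⟨Circuit.const _ b, (Circuit.const_isOver_acBasis b).mono acBasis_subset_tcBasis, le_rfl,
    isSymmetricUnder_of_singleton_nullary _ (fun _ => b) rfl rfl Γ, fun x => Circuit.eval_const b x⟩

/-- `HAM_1` has a one-gate symmetric circuit, under every `Γ`. -/
theorem hasSym_hamFn_one (Γ : Set (Equiv.Perm (Fin 1))) : HasSymCircuit tcBasis Γ 1 (fun x : Fin 1 × Fin 1 → Bool =>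
        decide (SimpleGraph.fromRel fun u v => x (u, v) = true).IsHamiltonian) := by
  rw [hamFn_one]; exact hasSym_const 1 Γ true

/-- `HAM_2` has a one-gate symmetric circuit, under every `Γ`. -/
theorem hasSym_hamFn_two (Γ : Set (Equiv.Perm (Fin 2))) : HasSymCircuit tcBasis Γ 1 (fun x : Fin 2 × Fin 2 → Bool =>
        decide (SimpleGraph.fromRel fun u v => x (u, v) = true).IsHamiltonian) := by
  rw [hamFn_two]; exact hasSym_const 2 Γ false

/-- The tempting mis-strengthening of the crux "for every polynomial and EVERY `m ≥ 1`" is false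
already at `p = 1`, `m = 1`. -/
theorem not_windowHam_everywhere :
    ¬ ∀ p : Polynomial ℕ, ∀ m : ℕ, 1 ≤ m →
      ¬ HasSymCircuit tcBasis (pointStabiliserBudget m (Nat.log 2 m)) (p.eval m) (fun x : Fin m × Fin m → Bool =>
        decide (SimpleGraph.fromRel fun u v => x (u, v) = true).IsHamiltonian) :=
  fun h => h 1 1 le_rfl (by simpa using hasSym_hamFn_one (pointStabiliserBudget 1 (Nat.log 2 1)))

/-! ## §5 On `Γ`-fixed inputs symmetric = general -/

/-- A circuit all of whose wires to inputs hit `Γ`-fixed matrix entries (e.g. only ordered × ordered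
entries, for `Γ = Bud m g`) is `Γ`-symmetric, with the identity as the induced automorphism. -/
theorem isSymmetricUnder_of_inputs_fixed {m : ℕ} (Γ : Set (Equiv.Perm (Fin m)))
    (C : Circuit (Fin m × Fin m))
    (hin : ∀ g ∈ C.gates, ∀ (a : Fin g.arity) (q : Fin m × Fin m), g.args a = .inl q →
      ∀ ρ ∈ Γ, (ρ q.1, ρ q.2) = q)
    (hout : ∀ q : Fin m × Fin m, C.output = .inl q → ∀ ρ ∈ Γ, (ρ q.1, ρ q.2) = q) :
    C.IsSymmetricUnder Γ := by
  intro ρ hρ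
  have hG : ∀ k : ℕ, Circuit.relabelGate (1 : Equiv.Perm (Fin C.gates.length)) k = k := by
    intro k
    by_cases hk : k < C.gates.length
    · rw [Circuit.relabelGate_of_lt _ hk]; rfl
    · exact Circuit.relabelGate_of_le _ (Nat.not_lt.1 hk)
  refine ⟨1, ?_, fun j => ⟨rfl, ?_⟩⟩
  · cases hC : C.output with
    | inl q =>
      show Sum.inl (ρ q.1, ρ q.2) = Sum.inl q
      rw [hout q hC ρ hρ]
    | inr k =>
      show Sum.inr (Circuit.relabelGate (1 : Equiv.Perm (Fin C.gates.length)) k) = Sum.inr k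
      rw [hG]
  · have hfix : ∀ w ∈ List.ofFn (C.gates[j]).args,
        Circuit.relabelWire (fun q : Fin m × Fin m => (ρ q.1, ρ q.2))
          (1 : Equiv.Perm (Fin C.gates.length)) w = w := by
      intro w hw
      obtain ⟨a, rfl⟩ := List.mem_ofFn.1 hw
      cases ha : (C.gates[j]).args a with
      | inl q =>
        rw [Circuit.relabelWire_inl, hin _ (List.getElem_mem j.2) a q ha ρ hρ]
      | inr k => rw [Circuit.relabelWire_inr, hG]
    have hmap : (List.ofFn (C.gates[j]).args).map
        (Circuit.relabelWire (fun q : Fin m × Fin m => (ρ q.1, ρ q.2))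
          (1 : Equiv.Perm (Fin C.gates.length))) = List.ofFn (C.gates[j]).args := by
      conv_rhs => rw [← List.map_id (List.ofFn (C.gates[j]).args)]
      exact List.map_congr_left hfix
    show (List.ofFn (C.gates[((1 : Equiv.Perm (Fin C.gates.length)) j)]).args).Perm _
    rw [hmap]
    exact List.Perm.refl _

/-- Packaged: a circuit over `B` with `≤ s` gates computing `f` and wired only to `Γ`-fixed entries
witnesses `HasSymCircuit B Γ s f`. -/
theorem hasSymCircuit_of_inputs_fixed {m s : ℕ} {B : Set GateFn} (Γ : Set (Equiv.Perm (Fin m)))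
    {f : (Fin m × Fin m → Bool) → Bool} (C : Circuit (Fin m × Fin m)) (hB : C.IsOver B)
    (hs : C.size ≤ s) (hf : C.Computes f)
    (hin : ∀ g ∈ C.gates, ∀ (a : Fin g.arity) (q : Fin m × Fin m), g.args a = .inl q →
      ∀ ρ ∈ Γ, (ρ q.1, ρ q.2) = q)
    (hout : ∀ q : Fin m × Fin m, C.output = .inl q → ∀ ρ ∈ Γ, (ρ q.1, ρ q.2) = q) :
    HasSymCircuit B Γ s f :=
  ⟨C, hB, hs, isSymmetricUnder_of_inputs_fixed Γ C hin hout, hf⟩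

/-- The entries of the ordered block are fixed by the budget group. -/
theorem bud_fixes_ordered {m g : ℕ} {ρ : Equiv.Perm (Fin m)} (hρ : ρ ∈ pointStabiliserBudget m g)
    {q : Fin m × Fin m} (h1 : (q.1 : ℕ) + g < m) (h2 : (q.2 : ℕ) + g < m) : (ρ q.1, ρ q.2) = q :=
  Prod.ext (hρ q.1 h1) (hρ q.2 h2)

end Summit.PneNP.PneNP.Theorems.WindowHam.Negative
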